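import Summits.QuantumFields.BalabanUV.Beta.D1BFx.SliceTransferDefectWard

/-!
# `BalabanUV.Beta.D1BFx.SliceTransferDefectWardJet` — road «BF-x» for binder row D1, slot (K), row **(K8-L) «NON-LOCAL REDUCTION»**, PART 2d:
# THE FIRST JET OF THE DEFECT IN CLOSED FORM — `D₁ = −(E₁·𝒫₀ᵀ + 𝒫₀·E₁ᵀ) + 𝒫₀·(W₀ᵀK₁W₀)·𝒫₀ᵀ`, a functional of the first WARD FAILURE
# `E₁ = K₁W₀ + K₀W₁` only (owner FINDING F-g8-2 §1 «jets», reproduced there by finite differences; here kernel-checked)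

HONEST DEPENDENCY (cell records, verbatim): «continuum YM on T⁴ ⇐ BetaPertH ∧ nine spine estimates (0/9 proved); BetaPertH ⇐ (D1) ∧ (D4) ∧
CAP+tail; G-an2-4 gates asym, D1 and NE2/3/4.»  HONEST FRAMING (cell contract, verbatim): «discharging `BetaPertH` makes Bałaban's UV stability
UNCONDITIONAL — a real constructive-QFT result; it is NOT the continuum limit and NOT the Clay problem.»  THIS MODULE DISCHARGES NOTHING of (K),
of D1 or of the wall: [folklore] finite-dimensional matrix algebra over PARTS 1∕2a∕2c (`SliceTransferDefect`, `SliceTransferDefectJets`,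
`SliceTransferDefectWard`) BY NAME.  No definition, no `def … : Prop`, nothing cited, no wall binder instantiated, 0 sorry.  It does NOT decide
whether Bałaban's typed literal has `E₁ = 0` («WARD-L», the row's letter owners'); it prices a NON-zero `E₁` exactly at first order.
NOT D1, NOT BetaPertH, NOT continuum, NOT Clay.

ABSOLUTE RULE (cell charter, verbatim): «No internally-minted statement may enter as a cited fact. Every hypothesis is either kernel-proved in this
package or a verbatim quotation of a PUBLISHED theorem with page reference. The manuscript(s) under audit are NOT citable for their own disputed
steps — they are the thing under adjudication; programme-internal (2001/route/tribunal) claims are never citable.»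

THE STATEMENT (`deflJet₁_eq_wardFailure`).  A symmetric form with 1-jet `(K₀, K₁)`, a co-frame weight `B = TᵀAT` with 1-jets `(T₀, T₁)`, `(A₀, A₁)`
(`A•` symmetric; so `B₀ = gram₀ T₀ A₀`, `B₁ = gram₁ T₀ T₁ A₀ A₁`), gauge modes `(W₀, W₁)`, at a point where ONLY the order-0 Ward letter
`K₀W₀ = 0` holds (so the defect itself vanishes there, PART 2c `deflJet₀_eq_of_wardL`) and `T₀W₀`, `A₀` are invertible.  Then the first
deflated jet of `Y = K + B` (PART 2a `deflJet₁`, `= (K + defect K B W)₁`) is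

    deflJet₁ (K₀ + B₀) (K₁ + B₁) W₀ W₁ = K₁ − (E₁·𝒫₀ᵀ + 𝒫₀·E₁ᵀ) + 𝒫₀·(W₀ᵀK₁W₀)·𝒫₀ᵀ,

`E₁ := K₁W₀ + K₀W₁` (the first-order Ward failure), `𝒫₀ := T₀ᵀ((T₀W₀)⁻¹)ᵀ` (`= B₀W₀Φ₀⁻¹`, PART 2c `proj_of_coframe`: the weight `A` drops out),
`𝒫₀ᵀ = (T₀W₀)⁻¹T₀`; note `W₀ᵀK₁W₀ = W₀ᵀE₁`.  So `D₁ := (K + D)₁ − K₁` is an explicit functional of `E₁`, vanishing with it (PART 2c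
`deflJet₁_eq_of_wardL` is the case `E₁ = 0`, re-derived below as a check).  The owner's kit j119050 ∕ j119073 ∕ j119087–89 (finite differences,
error ∝ h²) and the seat's exact-ℚ difference quotients reproduce the same formula numerically; here it is a kernel identity.
CONTENT: §1 [folklore] `prodJet₁_defect_eq` (field-general: the product∕inverse-rule first jet of `u ↦ B − YWΦ⁻¹WᵀY` in closed form; no
symmetry of `K`, `A` used, left failure `E₁′ = W₀ᵀK₁ + W₁ᵀK₀` displayed separately); §2 [folklore] `deflJet₁_eq_sub_prodJet` (PART 2a's
`deflJet₁` IS that product-rule jet for symmetric `Y`), **`deflJet₁_eq_wardFailure`**, `deflJet₁_eq_of_wardFailure_zero` (check: `E₁ = 0` ⇒ `= K₁`).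
Provenance: D1 formalisation swarm leaf seat `b2b-balaban-beta-d1-formalise-leaf-04` gen 8 (claim «D1-BFx-K8L» PART 2, cut (ii) by the road
owner `b2b-balaban-beta-d1-p2` gen 8), 2026-08-21.
-/

noncomputable section

namespace Summit.QuantumFields.BalabanUV.Beta.D1BFx.SliceTransferDefectWardJet

open Matrix
open Summit.QuantumFields.BalabanUV.Beta.D1BFx.GramWeightJets (gram₀ gram₁)
open Summit.QuantumFields.BalabanUV.Beta.D1BFx.SliceTransferDefect (gram_add_of_ward)
open Summit.QuantumFields.BalabanUV.Beta.D1BFx.SliceTransferDefectJets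
open Summit.QuantumFields.BalabanUV.Beta.D1BFx.SliceTransferDefectWard (proj_of_coframe coproj_of_coframe)

/-! ## §1 The product-rule first jet of the defect in closed form (any field; no symmetry) -/

section Field

variable {𝕜 : Type*} [Field 𝕜]
variable {ν ρ : Type*} [Fintype ν] [Fintype ρ] [DecidableEq ρ]

/-- [folklore] **THE FIRST JET OF THE DEFECT, PRODUCT-RULE FORM** (F-g8-2 §1 «jets»).  Data (all named by hypothesis-equations): the 1-jets
`(K₀, K₁)`, `(W₀, W₁)`, `(T₀, T₁)`, `(A₀, A₁)`; `B₀ = T₀ᵀA₀T₀`, `B₁ = T₁ᵀA₀T₀ + T₀ᵀA₁T₀ + T₀ᵀA₀T₁` (product rule); `Y• = K• + B•`;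
`Φ₀ = W₀ᵀY₀W₀`, `Φ₁ = (W₁ᵀY₀ + W₀ᵀY₁)W₀ + W₀ᵀY₀W₁`; `𝒫₀ = T₀ᵀ((T₀W₀)⁻¹)ᵀ`; at a point with `K₀W₀ = 0`, `K₀ᵀW₀ = 0`, `T₀W₀` and `A₀` invertible.
Then `B₁ −` (the product∕inverse-rule first jet of `u ↦ Y·W·Φ⁻¹·Wᵀ·Y`, inverse jet `−Φ₀⁻¹Φ₁Φ₀⁻¹`) equals
`−(E₁·𝒫₀ᵀ + 𝒫₀·E₁′) + 𝒫₀·(W₀ᵀK₁W₀)·𝒫₀ᵀ` with the right ∕ left first Ward failures `E₁ = K₁W₀ + K₀W₁`, `E₁′ = W₀ᵀK₁ + W₁ᵀK₀`. -/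
theorem prodJet₁_defect_eq (K₀ K₁ B₀ B₁ Y₀ Y₁ : Matrix ν ν 𝕜) (W₀ W₁ : Matrix ν ρ 𝕜) (T₀ T₁ : Matrix ρ ν 𝕜) (A₀ A₁ Φ₀ Φ₁ : Matrix ρ ρ 𝕜)
    (P₀ : Matrix ν ρ 𝕜) (hKW : K₀ * W₀ = 0) (hKtW : K₀ᵀ * W₀ = 0) (hTW : IsUnit (T₀ * W₀).det) (hA : IsUnit A₀.det)
    (hB₀ : B₀ = T₀ᵀ * A₀ * T₀) (hB₁ : B₁ = T₁ᵀ * A₀ * T₀ + T₀ᵀ * A₁ * T₀ + T₀ᵀ * A₀ * T₁)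
    (hY₀ : Y₀ = K₀ + B₀) (hY₁ : Y₁ = K₁ + B₁) (hΦ₀ : Φ₀ = W₀ᵀ * Y₀ * W₀)
    (hΦ₁ : Φ₁ = (W₁ᵀ * Y₀ + W₀ᵀ * Y₁) * W₀ + W₀ᵀ * Y₀ * W₁) (hP₀ : P₀ = T₀ᵀ * ((T₀ * W₀)⁻¹)ᵀ) :
    B₁ - (Y₁ * W₀ * Φ₀⁻¹ * W₀ᵀ * Y₀ + Y₀ * W₁ * Φ₀⁻¹ * W₀ᵀ * Y₀ - Y₀ * W₀ * (Φ₀⁻¹ * Φ₁ * Φ₀⁻¹) * W₀ᵀ * Y₀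
        + Y₀ * W₀ * Φ₀⁻¹ * W₁ᵀ * Y₀ + Y₀ * W₀ * Φ₀⁻¹ * W₀ᵀ * Y₁)
      = -((K₁ * W₀ + K₀ * W₁) * P₀ᵀ + P₀ * (W₀ᵀ * K₁ + W₁ᵀ * K₀)) + P₀ * (W₀ᵀ * K₁ * W₀) * P₀ᵀ := by
  -- the Ward letter on the left
  have hWtK : W₀ᵀ * K₀ = 0 := by
    have := congrArg Matrix.transpose hKtW
    simpa [Matrix.transpose_mul] using this
  -- the zeroth-order projector identities `Y₀W₀Φ₀⁻¹ = 𝒫₀`, `Φ₀⁻¹W₀ᵀY₀ = 𝒫₀ᵀ`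
  have hYW : Y₀ * W₀ = B₀ * W₀ := by rw [hY₀, Matrix.add_mul, hKW, zero_add]
  have hWY : W₀ᵀ * Y₀ = W₀ᵀ * B₀ := by rw [hY₀, Matrix.mul_add, hWtK, zero_add]
  have hΦB : Φ₀ = W₀ᵀ * B₀ * W₀ := by rw [hΦ₀, hY₀, gram_add_of_ward B₀ W₀ hKW]
  have hP : Y₀ * W₀ * Φ₀⁻¹ = P₀ := by rw [hYW, hΦB, hB₀, hP₀]; exact proj_of_coframe T₀ A₀ W₀ hTW hA
  have hPt : Φ₀⁻¹ * W₀ᵀ * Y₀ = P₀ᵀ := by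
    rw [Matrix.mul_assoc, hWY, ← Matrix.mul_assoc, hΦB, hB₀, hP₀, Matrix.transpose_mul, Matrix.transpose_transpose,
      Matrix.transpose_transpose]
    exact coproj_of_coframe T₀ A₀ W₀ hTW hA
  -- the five product-rule terms through `𝒫₀`
  have t1 : Y₁ * W₀ * Φ₀⁻¹ * W₀ᵀ * Y₀ = Y₁ * W₀ * P₀ᵀ := by
    rw [← hPt]; simp only [Matrix.mul_assoc]
  have t2 : Y₀ * W₁ * Φ₀⁻¹ * W₀ᵀ * Y₀ = Y₀ * W₁ * P₀ᵀ := by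
    rw [← hPt]; simp only [Matrix.mul_assoc]
  have t3 : Y₀ * W₀ * (Φ₀⁻¹ * Φ₁ * Φ₀⁻¹) * W₀ᵀ * Y₀ = P₀ * Φ₁ * P₀ᵀ := by
    rw [← hPt, ← hP]; simp only [Matrix.mul_assoc]
  have t4 : Y₀ * W₀ * Φ₀⁻¹ * W₁ᵀ * Y₀ = P₀ * W₁ᵀ * Y₀ := by rw [hP]
  have t5 : Y₀ * W₀ * Φ₀⁻¹ * W₀ᵀ * Y₁ = P₀ * W₀ᵀ * Y₁ := by rw [hP]
  rw [t1, t2, t3, t4, t5]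
  -- contraction rules for the co-frame `T₀W₀(T₀W₀)⁻¹ = 1` on both sides; then expand and cancel
  set J : Matrix ρ ρ 𝕜 := T₀ * W₀ with hJ
  have hR : ∀ X : Matrix ρ ν 𝕜, T₀ * (W₀ * (J⁻¹ * X)) = X := by
    intro X
    rw [← Matrix.mul_assoc W₀, ← Matrix.mul_assoc T₀, ← Matrix.mul_assoc T₀, mul_nonsing_inv _ hTW, Matrix.one_mul]
  have hL : ∀ X : Matrix ρ ν 𝕜, (J⁻¹)ᵀ * (W₀ᵀ * (T₀ᵀ * X)) = X := by
    intro X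
    rw [← Matrix.mul_assoc W₀ᵀ, ← Matrix.mul_assoc (J⁻¹)ᵀ, ← Matrix.mul_assoc (J⁻¹)ᵀ, ← Matrix.transpose_mul,
      ← Matrix.transpose_mul, ← Matrix.mul_assoc, mul_nonsing_inv _ hTW, Matrix.transpose_one, Matrix.one_mul]
  have hPt' : P₀ᵀ = J⁻¹ * T₀ := by rw [hP₀, Matrix.transpose_mul, Matrix.transpose_transpose, Matrix.transpose_transpose]
  rw [hPt', hP₀, hΦ₁, hY₁, hY₀, hB₁, hB₀]
  simp only [Matrix.mul_add, Matrix.add_mul, Matrix.mul_assoc, hR, hL, hKW, hWtK, Matrix.mul_zero, zero_add]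
  abel

end Field

/-! ## §2 PART 2a's `deflJet₁` is that product-rule jet; the closed form in the road's letters -/

section Real

variable {ν ρ : Type*} [Fintype ν] [Fintype ρ] [DecidableEq ρ]

/-- [folklore] BRIDGE: for symmetric `Y₀`, `Y₁`, PART 2a's first deflated jet `deflJet₁ Y₀ Y₁ W₀ W₁` (co-frame currency) IS `Y₁ −` the
product∕inverse-rule first jet of `u ↦ Y·W·(WᵀYW)⁻¹·Wᵀ·Y` (five terms; `Φ₀`, `Φ₁` named by hypothesis-equations). -/
theorem deflJet₁_eq_sub_prodJet (Y₀ Y₁ : Matrix ν ν ℝ) (W₀ W₁ : Matrix ν ρ ℝ) (Φ₀ Φ₁ : Matrix ρ ρ ℝ) (hY₀ : Y₀ᵀ = Y₀) (hY₁ : Y₁ᵀ = Y₁)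
    (hΦ₀ : Φ₀ = W₀ᵀ * Y₀ * W₀) (hΦ₁ : Φ₁ = (W₁ᵀ * Y₀ + W₀ᵀ * Y₁) * W₀ + W₀ᵀ * Y₀ * W₁) :
    deflJet₁ Y₀ Y₁ W₀ W₁
      = Y₁ - (Y₁ * W₀ * Φ₀⁻¹ * W₀ᵀ * Y₀ + Y₀ * W₁ * Φ₀⁻¹ * W₀ᵀ * Y₀ - Y₀ * W₀ * (Φ₀⁻¹ * Φ₁ * Φ₀⁻¹) * W₀ᵀ * Y₀
          + Y₀ * W₀ * Φ₀⁻¹ * W₁ᵀ * Y₀ + Y₀ * W₀ * Φ₀⁻¹ * W₀ᵀ * Y₁) := by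
  have e₀ : gram₀ W₀ Y₀ = Φ₀ := by rw [hΦ₀]; rfl
  have e₁ : gram₁ W₀ W₁ Y₀ Y₁ = Φ₁ := by rw [hΦ₁]; rfl
  simp only [deflJet₁, coT₁, invJet₁, e₀, e₁]
  simp only [gram₁, Matrix.transpose_add, Matrix.transpose_mul, Matrix.transpose_transpose, hY₀, hY₁, Matrix.mul_add, Matrix.add_mul,
    Matrix.neg_mul, Matrix.mul_neg, Matrix.mul_assoc]
  abel

/-- [folklore] **THE FIRST DEFLATED JET IN CLOSED FORM THROUGH THE WARD FAILURE** (F-g8-2 §1).  Symmetric form jets `K₀`, `K₁`; co-frame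
weight jets `B₀ = gram₀ T₀ A₀`, `B₁ = gram₁ T₀ T₁ A₀ A₁` (`A₀`, `A₁` symmetric); ONLY the order-0 letter `K₀W₀ = 0`; `T₀W₀`, `A₀` invertible.
Then, with `E₁ := K₁W₀ + K₀W₁` and `𝒫₀ := T₀ᵀ((T₀W₀)⁻¹)ᵀ` (`𝒫₀ᵀ = (T₀W₀)⁻¹T₀`):
`deflJet₁ (K₀ + B₀) (K₁ + B₁) W₀ W₁ = K₁ − (E₁·𝒫₀ᵀ + 𝒫₀·E₁ᵀ) + 𝒫₀·(W₀ᵀK₁W₀)·𝒫₀ᵀ`. -/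
theorem deflJet₁_eq_wardFailure (K₀ K₁ : Matrix ν ν ℝ) (T₀ T₁ : Matrix ρ ν ℝ) (A₀ A₁ : Matrix ρ ρ ℝ) (W₀ W₁ : Matrix ν ρ ℝ)
    (hK₀ : K₀ᵀ = K₀) (hK₁ : K₁ᵀ = K₁) (hA₀ : A₀ᵀ = A₀) (hA₁ : A₁ᵀ = A₁) (a0 : K₀ * W₀ = 0) (hTW : (T₀ * W₀).det ≠ 0)
    (hA : A₀.det ≠ 0) :
    deflJet₁ (K₀ + gram₀ T₀ A₀) (K₁ + gram₁ T₀ T₁ A₀ A₁) W₀ W₁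
      = K₁ - ((K₁ * W₀ + K₀ * W₁) * ((T₀ * W₀)⁻¹ * T₀) + T₀ᵀ * ((T₀ * W₀)⁻¹)ᵀ * (K₁ * W₀ + K₀ * W₁)ᵀ)
        + T₀ᵀ * ((T₀ * W₀)⁻¹)ᵀ * (W₀ᵀ * K₁ * W₀) * ((T₀ * W₀)⁻¹ * T₀) := by
  have a0t : K₀ᵀ * W₀ = 0 := by rw [hK₀]; exact a0
  have hB₀t : (gram₀ T₀ A₀)ᵀ = gram₀ T₀ A₀ := by
    simp only [gram₀, Matrix.transpose_mul, Matrix.transpose_transpose, hA₀, Matrix.mul_assoc]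
  have hB₁t : (gram₁ T₀ T₁ A₀ A₁)ᵀ = gram₁ T₀ T₁ A₀ A₁ := gram₁_transpose_of_symm T₀ T₁ hA₀ hA₁
  have hY₀ : (K₀ + gram₀ T₀ A₀)ᵀ = K₀ + gram₀ T₀ A₀ := by rw [Matrix.transpose_add, hK₀, hB₀t]
  have hY₁ : (K₁ + gram₁ T₀ T₁ A₀ A₁)ᵀ = K₁ + gram₁ T₀ T₁ A₀ A₁ := by rw [Matrix.transpose_add, hK₁, hB₁t]
  have hB₁ : gram₁ T₀ T₁ A₀ A₁ = T₁ᵀ * A₀ * T₀ + T₀ᵀ * A₁ * T₀ + T₀ᵀ * A₀ * T₁ := by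
    simp only [gram₁, Matrix.add_mul]
  have hb := deflJet₁_eq_sub_prodJet (K₀ + gram₀ T₀ A₀) (K₁ + gram₁ T₀ T₁ A₀ A₁) W₀ W₁ _ _ hY₀ hY₁ rfl rfl
  have hd := prodJet₁_defect_eq K₀ K₁ (gram₀ T₀ A₀) (gram₁ T₀ T₁ A₀ A₁) (K₀ + gram₀ T₀ A₀) (K₁ + gram₁ T₀ T₁ A₀ A₁) W₀ W₁ T₀ T₁
    A₀ A₁ _ _ _ a0 a0t (isUnit_iff_ne_zero.2 hTW) (isUnit_iff_ne_zero.2 hA) rfl hB₁ rfl rfl rfl rfl rfl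
  rw [hb, add_sub_assoc, hd]
  simp only [Matrix.transpose_add, Matrix.transpose_mul, Matrix.transpose_transpose, hK₀, hK₁]
  abel

/-- [folklore] CHECK (= PART 2c `deflJet₁_eq_of_wardL` through the closed form): if moreover the first Ward failure vanishes, `E₁ = 0`, then
`deflJet₁ (K₀ + B₀) (K₁ + B₁) W₀ W₁ = K₁` (`W₀ᵀK₁W₀ = W₀ᵀE₁ − W₀ᵀK₀W₁ = 0`). -/
theorem deflJet₁_eq_of_wardFailure_zero (K₀ K₁ : Matrix ν ν ℝ) (T₀ T₁ : Matrix ρ ν ℝ) (A₀ A₁ : Matrix ρ ρ ℝ) (W₀ W₁ : Matrix ν ρ ℝ)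
    (hK₀ : K₀ᵀ = K₀) (hK₁ : K₁ᵀ = K₁) (hA₀ : A₀ᵀ = A₀) (hA₁ : A₁ᵀ = A₁) (a0 : K₀ * W₀ = 0) (aₛ : K₁ * W₀ + K₀ * W₁ = 0)
    (hTW : (T₀ * W₀).det ≠ 0) (hA : A₀.det ≠ 0) :
    deflJet₁ (K₀ + gram₀ T₀ A₀) (K₁ + gram₁ T₀ T₁ A₀ A₁) W₀ W₁ = K₁ := by
  have hWtK : W₀ᵀ * K₀ = 0 := by
    have := congrArg Matrix.transpose a0
    rwa [Matrix.transpose_mul, hK₀, Matrix.transpose_zero] at this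
  have hE : W₀ᵀ * K₁ * W₀ = 0 := by
    have h1 : W₀ᵀ * (K₁ * W₀ + K₀ * W₁) = 0 := by rw [aₛ, Matrix.mul_zero]
    rw [Matrix.mul_add, ← Matrix.mul_assoc W₀ᵀ K₀, hWtK, Matrix.zero_mul, add_zero, ← Matrix.mul_assoc] at h1
    exact h1
  rw [deflJet₁_eq_wardFailure K₀ K₁ T₀ T₁ A₀ A₁ W₀ W₁ hK₀ hK₁ hA₀ hA₁ a0 hTW hA, aₛ, hE]
  simp

end Real

end Summit.QuantumFields.BalabanUV.Beta.D1BFx.SliceTransferDefectWardJet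

end
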